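import Summits.QuantumFields.BalabanUV.Beta.GAN24.CovariantCurveTaylor
import Summits.QuantumFields.BalabanUV.T4Continuum.Support.RegularBackgroundTower

/-!
# `BalabanUV.Beta.GAN24.LinearChartCovariantTaylor` — binder row G-an2-4 ∕ (CONV-C), route R7 «TWO CURRENCIES», PART 243: THE EXACT ABELIAN COVARIANT VECTOR LAPLACIAN IN THE LINEAR
# CHART `U_s = 1 + isηA` OF A REAL LIPSCHITZ CONNECTION — NOTHING DISPLAYED BUT `(α, β)` AND EL₁ OF `A`.  For a volume-indexed family of REAL backgrounds `A_t` (the samples of a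
# connection at every spacing `η_k = L^{−k}`) that are Lipschitz backgrounds `(α, β)` uniformly in the volume, the transporter curve `U_{t,s}(x, x + η_ke_ν) = 1 + is·η_k·A_{t,ν}(x)`
# passes through `U = 1`, and EVERY s-derivative at `s = 0` of the inverse effective covariance of `Δ_a^{(k)} + (Δ^{U_{t,s},(k)} − Δ^{1,(k)})` (NE2's `covPert`, the EXACT abelian covariant
# Laplacian — the background enters through `U` AND `U*`) has the β-cell's whole `LimitRate` END on `ℤ^d`, modulo ONLY the pointwise limits of `A_t` at the fine integer readings.
# In this chart the jets terminate: `−w_s = −isA` (jets `−iA`, then `0`), `z_s(x) = s²Σ_ν A_ν(x − e_ν)²` (jets `0, 0, 2Σ_νA_ν(x − e_ν)², 0, …`; the `O(s)` part of `z` VANISHES because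
# `A` is real: `−η⁻¹[(w − w∘τ⁻¹) + (w̄ − w̄∘τ⁻¹)] = 0` for `w = isA`), so PART 242's displayed hypotheses are discharged from `A`'s: the shifted square `x ↦ 2Σ_νA_ν(x − e_ν)²` is a
# bounded background `(2dα², 8dαβ)` by NE2's shifted-site block geometry (`RegularBackgroundTower.parT_tauInv_cases_lev`) (unit b2b-balaban-gan24-p3, gen 65; v1)

HONEST REMARK.  The linear chart and the exponential chart `U_s = exp(isηA)` have the same tangent at `s = 0` but different higher jets (`∂²_s` of the exponential chart adds the
first-order letter of `w″(0) = −ηA²`, an `O(η)` tadpole); the `N`-th derivative along ANY smooth chart is PART 242; this file discharges its displayed jet hypotheses for the linear one.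
NOT IN PRINT; OUR PROOF ([folklore] bookkeeping BY NAME over PART 242 (`conv_iteratedDeriv_invCov_covariantCurve_of_tendsto`), NE2's `AbelianCovariantLaplacian` (`connV`, `zT`, `conn`, `zfield`,
`negConn`, `tauInv`), `RegularBackgroundTower.parT_tauInv_cases_lev`, `AbelianCovariantLaplacian.tau_tauInv`, Mathlib's `iteratedDeriv_mul_const_field`, `iteratedDeriv_succ'`, `iteratedDeriv_const`,
`HasDerivAt.ofReal_comp`, `Complex.ofRealCLM.contDiff`; [Balaban1985BackgroundPropagators] (3.3) p. 390, (3.35) p. 396 and [Balaban1987RG1] (1.20)–(1.22) p. 264 LOCATE the shapes; nothing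
printed is a hypothesis).
HONEST FRAMING (cell contract, verbatim): «discharging `BetaPertH` makes Bałaban's UV stability UNCONDITIONAL — a real constructive-QFT result; it is NOT the
continuum limit and NOT the Clay problem.»  HONEST DEPENDENCY (verbatim): «continuum YM on T⁴ ⇐ BetaPertH ∧ nine spine estimates (0/9 proved); BetaPertH ⇐
(D1) ∧ (D4) ∧ CAP+tail; G-an2-4 gates asym, D1 and NE2/3/4.»

WHAT THIS FILE PROVES (0 sorry, 0 `def`; `U^A_s k ν x = 1 + (s : ℂ)·(I·A k ν x)∕n_k`, `A` REAL):
* §1 `conn_linearChart` (`w_s = isA`), **`connV_linearChart`** (`−w_s = s·(−iA)`), **`zT_linearChart`** (`z_s = s²·Σ_ν A_ν(τ_ν⁻¹·)²`), `contDiff_linearChart_entry`.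
* §2 `iteratedDeriv_ofReal_zero_eq` (`∂^j_s s|₀ = [j = 1]`), `iteratedDeriv_ofReal_sq_zero_eq` (`∂^j_s s²|₀ = 2[j = 2]`), **`iteratedDeriv_connV_linearChart`**,
  **`iteratedDeriv_zT_linearChart`** (the jets at `s = 0`).
* §3 `lipschitzBackground_constI_mul` (`x ↦ c·(−iA)`, `‖c‖ ≤ 1`), `norm_sub_parT_tauInv_le_scalar`, `norm_tauInv_sub_tauInv_parT_le_scalar` (scalar twins of NE2's shifted-site lemmas),
  **`boundedBackground_const_mul_sqShift`** (`x ↦ c·Σ_νA_ν(x − e_ν)²`, `‖c‖ ≤ 2`: bounded background `(2dα², 2d·2α(β+β))`).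
* §4 **`conv_iteratedDeriv_invCov_linearChart_of_tendsto`** (`d ≥ 3`, `L ≥ 2`, `a > 0`, `μ ≠ ν`, even cubic volumes, every order `N`): for REAL `A_t` with
  `LipschitzBackground (α, β)` uniformly in `t` and EL₁, the tower family `(t, k) ↦ ∂^N_s[(L^{dk}Q_k(Δ_a^{(k)} + covPert U^{A_t}_s k)⁻¹Q_kᴴ)⁻¹]|_{s=0}` has `∃ κ > 0, B, B′ ≥ 0, Π` with
  `IsInfiniteVolumeLimit`, `UniformDecay`, `StepRate (√(L⁻¹))`, `KernelInputs`, `|secondMoment (Π k) − secondMoment (lim Π)| ≤ β′_d(B′∕(1−√(L⁻¹)), κ∕d)(√(L⁻¹))^k`.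
WHAT IT DOES NOT DO: the exponential chart's jets; several parameters; Bałaban's `−∂P∂*` ∕ `aQ(U)*Q(U)` parts and the non-abelian colour structure; `d ≤ 2` ∕ odd volumes.  SUPPLIER work;
NEVER «G-an2-4 closed»; NOT (CONV-C), NOT D1, NOT `BetaPertH`, NOT continuum, NOT Clay.  Records: `HOME/b2b-balaban-gan24-p3/gen65/README.md`.
-/

noncomputable section

open scoped BigOperators ComplexConjugate Matrix Matrix.Norms.L2Operator
open Filter Topology

namespace Summit.QuantumFields.BalabanUV.Beta.GAN24.LinearChartCovariantTaylor

open Literature.MathematicalPhysics.QuantumFieldTheory.Balaban1983to89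
open Literature.MathematicalPhysics.QuantumFieldTheory.Balaban1983to89.B5Prop11Plancherel (Tor fine)
open Literature.MathematicalPhysics.QuantumFieldTheory.Balaban1983to89.B5G183RateUnitTower (lev)
open Literature.MathematicalPhysics.QuantumFieldTheory.Balaban1983to89.B12Sec2to5 (betaPrime510)
open Literature.MathematicalPhysics.QuantumFieldTheory.Balaban1983to89.Beta (Site IsInfiniteVolumeLimit)
open Literature.MathematicalPhysics.QuantumFieldTheory.Balaban1983to89.Beta.FreeLegDictionary (cubic)
open Literature.MathematicalPhysics.QuantumFieldTheory.Balaban1983to89.Beta.BlockKernelVolumeSockets (evenPeriod)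
open Literature.MathematicalPhysics.QuantumFieldTheory.Balaban1983to89.Beta.VectorTails (castT castT_add castT_neg castT_single)
open Literature.MathematicalPhysics.QuantumFieldTheory.Balaban1983to89.Beta.LimitRate (StepRate limKernelOf KernelInputs)
open Summit.QuantumFields.BalabanUV.T4Continuum
open Summit.QuantumFields.BalabanUV.T4Continuum.CovariantAveragingTower (avgTow)
open Summit.QuantumFields.BalabanUV.T4Continuum.BalabanAveragedTowerUnit (idx QBlev one_le_lev')
open Summit.QuantumFields.BalabanUV.T4Continuum.BalabanAveragedCoerciveTower (unitIdx)
open Summit.QuantumFields.BalabanUV.T4Continuum.KingPairingPlantedLaw (calDalev)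
open Summit.QuantumFields.BalabanUV.T4Continuum.BlockPairingGeometry (tau parT)
open Summit.QuantumFields.BalabanUV.T4Continuum.FirstOrderBackgroundModel (LipschitzBackground)
open Summit.QuantumFields.BalabanUV.T4Continuum.PerturbationAlgebra (BoundedBackground)
open Summit.QuantumFields.BalabanUV.T4Continuum.AbelianCovariantLaplacian (covPert connV zT conn zfield negConn tauInv tau_tauInv)
open Summit.QuantumFields.BalabanUV.T4Continuum.RegularBackgroundTower (parT_tauInv_cases_lev)
open Summit.QuantumFields.BalabanUV.Beta.GAN24.CovariantCurveTaylor (conv_iteratedDeriv_invCov_covariantCurve_of_tendsto)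

variable {d : ℕ} (L : ℕ) [NeZero L]

/-! ## §1 The linear chart: connection and zeroth-order field -/

section Chart

variable (M : Fin d → ℕ) [hM : ∀ μ, NeZero (M μ)]

omit hM in
/-- `w_s = η⁻¹(U_s − 1) = isA` in the linear chart `U_s = 1 + isA∕n` (`n = η⁻¹ ≠ 0`). [folklore] -/
theorem conn_linearChart (A : (k : ℕ) → Fin d → (idx L M k → ℝ)) (s : ℝ) (k : ℕ) (ν : Fin d) (x : idx L M k) :
    conn (fine (lev L k) M) ((lev L k : ℕ) : ℂ) (fun ν' x' => 1 + (s : ℂ) * (Complex.I * (A k ν' x' : ℂ)) / ((lev L k : ℕ) : ℂ)) ν x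
      = (s : ℂ) * (Complex.I * (A k ν x : ℂ)) := by
  have hc : ((lev L k : ℕ) : ℂ) ≠ 0 := by exact_mod_cast (NeZero.ne (lev L k))
  simp only [conn, add_sub_cancel_left]
  rw [mul_div_cancel₀ _ hc]

omit hM in
/-- **`connV_linearChart`**: `−w_s = s·(−iA)` at every level. [folklore] -/
theorem connV_linearChart (A : (k : ℕ) → Fin d → (idx L M k → ℝ)) (s : ℝ) :
    connV L M (fun k ν x => 1 + (s : ℂ) * (Complex.I * (A k ν x : ℂ)) / ((lev L k : ℕ) : ℂ)) = fun k ν x => (s : ℂ) * (-(Complex.I * (A k ν x : ℂ))) := by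
  funext k ν x
  simp only [connV, negConn]
  rw [conn_linearChart]
  ring

omit [NeZero L] in
/-- `(s·(iA))* = −s·(iA)` for real `s`, `A`. [folklore] -/
theorem star_real_mul_I_mul_real (s r : ℝ) : star ((s : ℂ) * (Complex.I * (r : ℂ))) = -((s : ℂ) * (Complex.I * (r : ℂ))) := by
  rw [Complex.star_def, map_mul, map_mul, Complex.conj_ofReal, Complex.conj_ofReal, Complex.conj_I]
  ring

omit hM in
/-- **`zT_linearChart`**: in the linear chart of a REAL connection the zeroth-order field is `z_s(x) = s²·Σ_ν A_ν(x − e_ν)²` — its `O(s)` part vanishes identically. [folklore] -/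
theorem zT_linearChart (A : (k : ℕ) → Fin d → (idx L M k → ℝ)) (s : ℝ) :
    zT L M (fun k ν x => 1 + (s : ℂ) * (Complex.I * (A k ν x : ℂ)) / ((lev L k : ℕ) : ℂ))
      = fun k x => (s : ℂ) ^ 2 * ∑ ν, ((A k ν (tauInv (fine (lev L k) M) ν x) : ℝ) : ℂ) ^ 2 := by
  funext k x
  simp only [zT, zfield]
  rw [Finset.mul_sum]
  refine Finset.sum_congr rfl fun ν _ => ?_
  rw [conn_linearChart, conn_linearChart, star_real_mul_I_mul_real, star_real_mul_I_mul_real]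
  linear_combination (-((s : ℂ) ^ 2) * ((A k ν (tauInv (fine (lev L k) M) ν x) : ℝ) : ℂ) ^ 2) * Complex.I_mul_I

omit [NeZero L] hM in
/-- the entries of the linear chart are `C^∞` in `s` (affine). [folklore] -/
theorem contDiff_linearChart_entry (A : (k : ℕ) → Fin d → (idx L M k → ℝ)) (k : ℕ) (ν : Fin d) (x : idx L M k) (n : ℕ) :
    ContDiff ℝ n (fun s : ℝ => 1 + (s : ℂ) * (Complex.I * (A k ν x : ℂ)) / ((lev L k : ℕ) : ℂ)) :=
  contDiff_const.add ((Complex.ofRealCLM.contDiff.mul contDiff_const).div_const _)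

end Chart

/-! ## §2 The jets at `s = 0` -/

section Jets

omit [NeZero L] in
/-- `∂^j_s s|_{s=0} = [j = 1]` (the first derivative `∂_s(s : ℂ) = 1` is the tree's `RootForms.deriv_ofReal_eq` pattern, inlined). [folklore] -/
theorem iteratedDeriv_ofReal_zero_eq (j : ℕ) : iteratedDeriv j (fun s : ℝ => (s : ℂ)) 0 = if j = 1 then 1 else 0 := by
  have hd : deriv (fun s : ℝ => (s : ℂ)) = fun _ => (1 : ℂ) := by
    funext s
    have h := ((hasDerivAt_id s).ofReal_comp).deriv
    simpa using h
  rcases j with _ | _ | j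
  · simp [iteratedDeriv_zero]
  · simp [iteratedDeriv_one, hd]
  · rw [iteratedDeriv_succ', iteratedDeriv_succ', hd]
    simp

omit [NeZero L] in
/-- `∂_s (s : ℂ)² = 2s`. [folklore] -/
theorem deriv_ofReal_sq : deriv (fun s : ℝ => (s : ℂ) ^ 2) = fun s : ℝ => 2 * (s : ℂ) := by
  have e : (fun s : ℝ => (s : ℂ) ^ 2) = fun s : ℝ => (s : ℂ) * (s : ℂ) := funext fun s => sq _
  rw [e]
  funext s
  have h := (((hasDerivAt_id s).ofReal_comp).fun_mul ((hasDerivAt_id s).ofReal_comp)).deriv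
  simp only [id] at h
  rw [h]
  push_cast
  ring

omit [NeZero L] in
/-- `∂^j_s s²|_{s=0} = 2·[j = 2]`. [folklore] -/
theorem iteratedDeriv_ofReal_sq_zero_eq (j : ℕ) : iteratedDeriv j (fun s : ℝ => (s : ℂ) ^ 2) 0 = if j = 2 then 2 else 0 := by
  rcases j with _ | _ | _ | j
  · simp [iteratedDeriv_zero]
  · simp [iteratedDeriv_one, deriv_ofReal_sq]
  · rw [iteratedDeriv_succ', iteratedDeriv_succ', deriv_ofReal_sq]
    have h2 : deriv (fun s : ℝ => (2 : ℂ) * (s : ℂ)) = fun _ => (2 : ℂ) := by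
      funext s
      have h := (((hasDerivAt_id s).ofReal_comp).const_mul (2 : ℂ)).deriv
      simpa using h
    rw [h2]
    simp [iteratedDeriv_zero]
  · rw [iteratedDeriv_succ', iteratedDeriv_succ', iteratedDeriv_succ', deriv_ofReal_sq]
    have h2 : deriv (fun s : ℝ => (2 : ℂ) * (s : ℂ)) = fun _ => (2 : ℂ) := by
      funext s
      have h := (((hasDerivAt_id s).ofReal_comp).const_mul (2 : ℂ)).deriv
      simpa using h
    rw [h2, deriv_const']
    simp

variable (M : Fin d → ℕ) [hM : ∀ μ, NeZero (M μ)]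

omit hM in
/-- **the jets of `−w` at `s = 0` in the linear chart**: `∂^j_s(−w_s)^{(k)}_ν(x)|₀ = [j = 1]·(−iA^{(k)}_ν(x))`. [folklore] -/
theorem iteratedDeriv_connV_linearChart (A : (k : ℕ) → Fin d → (idx L M k → ℝ)) (j k : ℕ) (ν : Fin d) (x : idx L M k) :
    iteratedDeriv j (fun s : ℝ => connV L M (fun k' ν' x' => 1 + (s : ℂ) * (Complex.I * (A k' ν' x' : ℂ)) / ((lev L k' : ℕ) : ℂ)) k ν x) 0
      = (if j = 1 then (1 : ℂ) else 0) * (-(Complex.I * (A k ν x : ℂ))) := by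
  simp only [connV_linearChart]
  rw [iteratedDeriv_mul_const_field, iteratedDeriv_ofReal_zero_eq]

omit hM in
/-- **the jets of `z` at `s = 0` in the linear chart**: `∂^j_s z^{(k)}_s(x)|₀ = 2[j = 2]·Σ_ν A^{(k)}_ν(x − e_ν)²`. [folklore] -/
theorem iteratedDeriv_zT_linearChart (A : (k : ℕ) → Fin d → (idx L M k → ℝ)) (j k : ℕ) (x : idx L M k) :
    iteratedDeriv j (fun s : ℝ => zT L M (fun k' ν' x' => 1 + (s : ℂ) * (Complex.I * (A k' ν' x' : ℂ)) / ((lev L k' : ℕ) : ℂ)) k x) 0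
      = (if j = 2 then (2 : ℂ) else 0) * ∑ ν, ((A k ν (tauInv (fine (lev L k) M) ν x) : ℝ) : ℂ) ^ 2 := by
  simp only [zT_linearChart]
  rw [iteratedDeriv_mul_const_field, iteratedDeriv_ofReal_sq_zero_eq]

end Jets

/-! ## §3 The jets are backgrounds: `c·(−iA)` Lipschitz, `c·Σ_νA(· − e_ν)²` bounded (shifted-site block geometry) -/

section Backgrounds

variable (M : Fin d → ℕ) [hM : ∀ μ, NeZero (M μ)]

omit [NeZero L] hM in
/-- `x ↦ c·(−iA(x))` with `‖c‖ ≤ 1` is a Lipschitz background `(α, β)` when `A` is. [folklore] -/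
theorem lipschitzBackground_constI_mul {A : (k : ℕ) → Fin d → (idx L M k → ℝ)} {α β : ℝ} (hA : LipschitzBackground L M (fun k ν x => (A k ν x : ℂ)) α β)
    {c : ℂ} (hc : ‖c‖ ≤ 1) : LipschitzBackground L M (fun k ν x => c * (-(Complex.I * (A k ν x : ℂ)))) α β where
  nonneg := hA.nonneg
  bound := fun k μ i => by
    have h := hA.bound k μ i
    calc ‖c * (-(Complex.I * (A k μ i : ℂ)))‖ = ‖c‖ * ‖(A k μ i : ℂ)‖ := by rw [norm_mul, norm_neg, norm_mul, Complex.norm_I, one_mul]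
      _ ≤ 1 * α := mul_le_mul hc h (norm_nonneg _) zero_le_one
      _ = α := one_mul α
  lipschitz := fun k μ ν i => by
    have h := hA.lipschitz k μ ν i
    have e : c * (-(Complex.I * (A k μ (tau (fine (lev L k) M) ν i) : ℂ))) - c * (-(Complex.I * (A k μ i : ℂ)))
        = -(c * Complex.I) * ((A k μ (tau (fine (lev L k) M) ν i) : ℂ) - (A k μ i : ℂ)) := by ring
    have en : ‖-(c * Complex.I) * ((A k μ (tau (fine (lev L k) M) ν i) : ℂ) - (A k μ i : ℂ))‖ = ‖c‖ * ‖(A k μ (tau (fine (lev L k) M) ν i) : ℂ) - (A k μ i : ℂ)‖ := by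
      simp only [norm_mul, norm_neg, Complex.norm_I, mul_one]
    calc _ = _ := congrArg Norm.norm e
      _ = _ := en
      _ ≤ 1 * (β / (lev L k : ℕ)) := mul_le_mul hc h (norm_nonneg _) zero_le_one
      _ = β / (lev L k : ℕ) := one_mul _
  consistent := fun k μ i => by
    have h := hA.consistent k μ i
    have e : c * (-(Complex.I * (A (k + 1) μ i : ℂ))) - c * (-(Complex.I * (A k μ (parT (lev L k) L M i) : ℂ)))
        = -(c * Complex.I) * ((A (k + 1) μ i : ℂ) - (A k μ (parT (lev L k) L M i) : ℂ)) := by ring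
    have en : ‖-(c * Complex.I) * ((A (k + 1) μ i : ℂ) - (A k μ (parT (lev L k) L M i) : ℂ))‖ = ‖c‖ * ‖(A (k + 1) μ i : ℂ) - (A k μ (parT (lev L k) L M i) : ℂ)‖ := by
      simp only [norm_mul, norm_neg, Complex.norm_I, mul_one]
    calc _ = _ := congrArg Norm.norm e
      _ = _ := en
      _ ≤ 1 * (β / (lev L k : ℕ)) := mul_le_mul hc h (norm_nonneg _) zero_le_one
      _ = β / (lev L k : ℕ) := one_mul _

/-- scalar twin of NE2's `norm_sub_parT_tauInv_le`: a lattice-Lipschitz tower differs by at most `β∕n_k` between `parT(τ_ν⁻¹x′)` and `τ_ν⁻¹(parT x′)`. [folklore] -/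
theorem norm_sub_parT_tauInv_le_scalar {W : (k : ℕ) → Fin d → (idx L M k → ℂ)} {β : ℝ} (hβ : 0 ≤ β)
    (hlip : ∀ k μ ν (i : idx L M k), ‖W k μ (tau (fine (lev L k) M) ν i) - W k μ i‖ ≤ β / (lev L k : ℕ)) (k : ℕ) (μ ν : Fin d) (i : idx L M (k + 1)) :
    ‖W k μ (parT (lev L k) L M (tauInv (fine (lev L (k + 1)) M) ν i)) - W k μ (tauInv (fine (lev L k) M) ν (parT (lev L k) L M i))‖ ≤ β / (lev L k : ℕ) := by
  rcases parT_tauInv_cases_lev k ν i with h | h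
  · rw [h]
    have h1 := hlip k μ ν (tauInv (fine (lev L k) M) ν (parT (lev L k) L M i))
    rwa [tau_tauInv] at h1
  · rw [h, sub_self, norm_zero]; exact div_nonneg hβ (Nat.cast_nonneg _)

/-- scalar twin of NE2's `norm_tauInv_sub_tauInv_parT_le`: consistency read at a backward-shifted site, `‖W′(τ⁻¹x′) − W(τ⁻¹(parT x′))‖ ≤ (βc + β)∕n_k`. [folklore] -/
theorem norm_tauInv_sub_tauInv_parT_le_scalar {W : (k : ℕ) → Fin d → (idx L M k → ℂ)} {β βc : ℝ} (hβ : 0 ≤ β)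
    (hlip : ∀ k μ ν (i : idx L M k), ‖W k μ (tau (fine (lev L k) M) ν i) - W k μ i‖ ≤ β / (lev L k : ℕ))
    (hcons : ∀ k μ (i : idx L M (k + 1)), ‖W (k + 1) μ i - W k μ (parT (lev L k) L M i)‖ ≤ βc / (lev L k : ℕ)) (k : ℕ) (μ ν : Fin d) (i : idx L M (k + 1)) :
    ‖W (k + 1) μ (tauInv (fine (lev L (k + 1)) M) ν i) - W k μ (tauInv (fine (lev L k) M) ν (parT (lev L k) L M i))‖ ≤ (βc + β) / (lev L k : ℕ) := by
  rw [add_div]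
  calc ‖W (k + 1) μ (tauInv (fine (lev L (k + 1)) M) ν i) - W k μ (tauInv (fine (lev L k) M) ν (parT (lev L k) L M i))‖
      ≤ ‖W (k + 1) μ (tauInv (fine (lev L (k + 1)) M) ν i) - W k μ (parT (lev L k) L M (tauInv (fine (lev L (k + 1)) M) ν i))‖
        + ‖W k μ (parT (lev L k) L M (tauInv (fine (lev L (k + 1)) M) ν i)) - W k μ (tauInv (fine (lev L k) M) ν (parT (lev L k) L M i))‖ :=
        norm_sub_le_norm_sub_add_norm_sub _ _ _
    _ ≤ βc / (lev L k : ℕ) + β / (lev L k : ℕ) := add_le_add (hcons k μ _) (norm_sub_parT_tauInv_le_scalar L M hβ hlip k μ ν i)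

/-- **`boundedBackground_const_mul_sqShift`** — `x ↦ c·Σ_ν A_ν(x − e_ν)²` with `‖c‖ ≤ 2` is a bounded background `(2dα², 2d·2α(β+β))` when `A` is a Lipschitz background `(α, β)`:
size `Σ_ν |A|² ≤ dα²`; two-level consistency from `|a′² − a²| ≤ (|a′| + |a|)|a′ − a|` and the shifted-site reading `‖A′(τ⁻¹x′) − A(τ⁻¹(parT x′))‖ ≤ (β + β)∕n_k`. [folklore] -/
theorem boundedBackground_const_mul_sqShift {A : (k : ℕ) → Fin d → (idx L M k → ℝ)} {α β : ℝ} (hA : LipschitzBackground L M (fun k ν x => (A k ν x : ℂ)) α β)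
    {c : ℂ} (hc : ‖c‖ ≤ 2) :
    BoundedBackground L M (fun k x => c * ∑ ν, ((A k ν (tauInv (fine (lev L k) M) ν x) : ℝ) : ℂ) ^ 2) (2 * (d * α ^ 2)) (2 * (d * (2 * α * (β + β)))) where
  nonneg := ⟨by have := hA.nonneg.1; positivity, by have := hA.nonneg.1; have := hA.nonneg.2; positivity⟩
  bound := fun k i => by
    have hα := hA.nonneg.1
    have hterm : ∀ ν ∈ Finset.univ, ‖((A k ν (tauInv (fine (lev L k) M) ν i) : ℝ) : ℂ) ^ 2‖ ≤ α ^ 2 := fun ν _ => by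
      rw [norm_pow]
      exact pow_le_pow_left₀ (norm_nonneg _) (hA.bound k ν _) 2
    calc ‖c * ∑ ν, ((A k ν (tauInv (fine (lev L k) M) ν i) : ℝ) : ℂ) ^ 2‖
        ≤ ‖c‖ * ∑ ν, ‖((A k ν (tauInv (fine (lev L k) M) ν i) : ℝ) : ℂ) ^ 2‖ := by rw [norm_mul]; exact mul_le_mul_of_nonneg_left (norm_sum_le _ _) (norm_nonneg _)
      _ ≤ 2 * ∑ _ν : Fin d, α ^ 2 := mul_le_mul hc (Finset.sum_le_sum hterm) (Finset.sum_nonneg fun _ _ => norm_nonneg _) zero_le_two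
      _ = 2 * (d * α ^ 2) := by rw [Finset.sum_const, Finset.card_univ, Fintype.card_fin, nsmul_eq_mul]
  consistent := fun k i => by
    obtain ⟨hα, hβ⟩ := hA.nonneg
    have hlev : (0 : ℝ) < (lev L k : ℕ) := by exact_mod_cast one_le_lev' L k
    have hdiff : ∀ ν, ‖((A (k + 1) ν (tauInv (fine (lev L (k + 1)) M) ν i) : ℝ) : ℂ) - ((A k ν (tauInv (fine (lev L k) M) ν (parT (lev L k) L M i)) : ℝ) : ℂ)‖
        ≤ (β + β) / (lev L k : ℕ) :=
      fun ν => norm_tauInv_sub_tauInv_parT_le_scalar L M (W := fun k ν x => (A k ν x : ℂ)) hβ hA.lipschitz hA.consistent k ν ν i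
    have hterm : ∀ ν ∈ Finset.univ, ‖((A (k + 1) ν (tauInv (fine (lev L (k + 1)) M) ν i) : ℝ) : ℂ) ^ 2 - ((A k ν (tauInv (fine (lev L k) M) ν (parT (lev L k) L M i)) : ℝ) : ℂ) ^ 2‖
        ≤ 2 * α * ((β + β) / (lev L k : ℕ)) := by
      intro ν _
      rw [sq_sub_sq, norm_mul]
      refine mul_le_mul ((norm_add_le _ _).trans ?_) (hdiff ν) (norm_nonneg _) (by positivity)
      have h1 := hA.bound (k + 1) ν (tauInv (fine (lev L (k + 1)) M) ν i)
      have h2 := hA.bound k ν (tauInv (fine (lev L k) M) ν (parT (lev L k) L M i))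
      linarith
    rw [← mul_sub, ← Finset.sum_sub_distrib, norm_mul]
    calc ‖c‖ * ‖∑ ν, (((A (k + 1) ν (tauInv (fine (lev L (k + 1)) M) ν i) : ℝ) : ℂ) ^ 2 - ((A k ν (tauInv (fine (lev L k) M) ν (parT (lev L k) L M i)) : ℝ) : ℂ) ^ 2)‖
        ≤ 2 * ∑ _ν : Fin d, 2 * α * ((β + β) / (lev L k : ℕ)) :=
          mul_le_mul hc ((norm_sum_le _ _).trans (Finset.sum_le_sum hterm)) (norm_nonneg _) zero_le_two
      _ = 2 * (d * (2 * α * (β + β))) / (lev L k : ℕ) := by rw [Finset.sum_const, Finset.card_univ, Fintype.card_fin, nsmul_eq_mul]; field_simp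

end Backgrounds

/-! ## §4 THE END in the linear chart, displaying only `(α, β)` and EL₁ of the real connection -/

section End

variable (a : ℝ) (ha : 0 < a)

/-- **`conv_iteratedDeriv_invCov_linearChart_of_tendsto` — THE EXACT ABELIAN COVARIANT VECTOR LAPLACIAN IN THE LINEAR CHART OF A REAL LIPSCHITZ CONNECTION: EVERY s-DERIVATIVE AT
`s = 0` OF THE INVERSE EFFECTIVE COVARIANCE HAS THE β-CELL's WHOLE `LimitRate` END ON `ℤ^d`, DISPLAYING ONLY `(α, β)` AND EL₁ OF `A`** [our proof] (`d ≥ 3`, `L ≥ 2`, `a > 0`, `μ ≠ ν`, even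
cubic volumes `2(t+1)`, every order `N`; `U^{A_t}_s(x, x + η_ke_ν') = 1 + is·A_{t,ν'}^{(k)}(x)∕n_k`).  PART 242 with its displayed jet hypotheses DISCHARGED by §2–§3: the jets at `s = 0` are
`[j=1]·(−iA_t)` (Lipschitz `(α, β)`) and `2[j=2]·Σ_ν'A_{t,ν'}(· − e_ν')²` (bounded `(2dα², 8dαβ)`), their EL₁ is EL₁ of `A_t` at `z` and `z − e_ν'`.
[cite: Balaban1985BackgroundPropagators, (3.3) p.390, (3.35) p.396 (shapes); Balaban1987RG1, (1.20)–(1.22) p.264 (shapes)] -/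
theorem conv_iteratedDeriv_invCov_linearChart_of_tendsto (hL : 2 ≤ L) (hd : 3 ≤ d) {μ ν : Fin d} (hne : μ ≠ ν) {α β : ℝ} (N : ℕ)
    {A : (t : ℕ) → (k : ℕ) → Fin d → (idx L (cubic d (evenPeriod t)) k → ℝ)}
    (hA : ∀ t, LipschitzBackground L (cubic d (evenPeriod t)) (fun k ν' x => (A t k ν' x : ℂ)) α β)
    (hA1 : ∀ k (ν' f : Fin d) (z : Fin d → ℤ), ∃ s' : ℂ, Tendsto (fun t => ((A t k ν' (castT (cubic d (lev L k * evenPeriod t)) z, f) : ℝ) : ℂ)) atTop (𝓝 s')) :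
    ∃ κ B B' : ℝ, 0 < κ ∧ 0 ≤ B ∧ 0 ≤ B' ∧ ∃ Pinf : ℕ → B12Beta.Kernel d,
      (∀ k, IsInfiniteVolumeLimit evenPeriod
        (fun t μ' ν' (z : Site d (evenPeriod t)) =>
          ((iteratedDeriv N (fun s : ℝ => (avgTow (QBlev L (cubic d (evenPeriod t))) ((L : ℝ) ^ d)
              (fun k' => (calDalev L (cubic d (evenPeriod t)) a ha k'
                + covPert L (cubic d (evenPeriod t)) (fun k'' ν'' x => 1 + (s : ℂ) * (Complex.I * (A t k'' ν'' x : ℂ)) / ((lev L k'' : ℕ) : ℂ)) k')⁻¹) k)⁻¹) 0)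
            ((unitIdx L (cubic d (evenPeriod t))).symm (z, μ')) ((unitIdx L (cubic d (evenPeriod t))).symm (0, ν'))).re) (Pinf k)) ∧
      Beta.LimitRate.UniformDecay Pinf μ ν B (κ / d) ∧ StepRate Pinf μ ν B' (κ / d) (Real.sqrt ((L : ℝ)⁻¹)) ∧
      (∃ K : KernelInputs d Pinf, K.θ = Real.sqrt ((L : ℝ)⁻¹) ∧ K.c₀ = betaPrime510 d (B' / (1 - Real.sqrt ((L : ℝ)⁻¹))) (κ / d) ∧ K.Pinf = limKernelOf Pinf ∧ K.μ = μ ∧ K.ν = ν) ∧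
      (∀ k, |B12Beta.secondMoment (Pinf k) μ ν - B12Beta.secondMoment (limKernelOf Pinf) μ ν|
          ≤ betaPrime510 d (B' / (1 - Real.sqrt ((L : ℝ)⁻¹))) (κ / d) * Real.sqrt ((L : ℝ)⁻¹) ^ k) := by
  have h1c : ∀ j : ℕ, ‖(if j = 1 then (1 : ℂ) else 0)‖ ≤ 1 := fun j => by split_ifs <;> simp
  have h2c : ∀ j : ℕ, ‖(if j = 2 then (2 : ℂ) else 0)‖ ≤ 2 := fun j => by split_ifs <;> simp
  refine conv_iteratedDeriv_invCov_covariantCurve_of_tendsto L a ha hL hd hne (α := α) (β := β) (α' := 2 * (d * α ^ 2)) (β' := 2 * (d * (2 * α * (β + β)))) N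
    (U := fun t s k ν' x => 1 + (s : ℂ) * (Complex.I * (A t k ν' x : ℂ)) / ((lev L k : ℕ) : ℂ))
    (fun t k ν' x n => contDiff_linearChart_entry L (cubic d (evenPeriod t)) (A t) k ν' x n)
    (fun t => by funext k ν' x; simp) ?_ ?_ ?_ ?_
  · intro j _ t
    have e : (fun k ν' x => iteratedDeriv j (fun s : ℝ => connV L (cubic d (evenPeriod t)) (fun k'' ν'' x' => 1 + (s : ℂ) * (Complex.I * (A t k'' ν'' x' : ℂ)) / ((lev L k'' : ℕ) : ℂ)) k ν' x) 0)
        = fun k ν' x => (if j = 1 then (1 : ℂ) else 0) * (-(Complex.I * (A t k ν' x : ℂ))) := by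
      funext k ν' x; exact iteratedDeriv_connV_linearChart L (cubic d (evenPeriod t)) (A t) j k ν' x
    rw [e]
    exact lipschitzBackground_constI_mul L (cubic d (evenPeriod t)) (hA t) (h1c j)
  · intro j _ t
    have e : (fun k x => iteratedDeriv j (fun s : ℝ => zT L (cubic d (evenPeriod t)) (fun k'' ν'' x' => 1 + (s : ℂ) * (Complex.I * (A t k'' ν'' x' : ℂ)) / ((lev L k'' : ℕ) : ℂ)) k x) 0)
        = fun k x => (if j = 2 then (2 : ℂ) else 0) * ∑ ν', ((A t k ν' (tauInv (fine (lev L k) (cubic d (evenPeriod t))) ν' x) : ℝ) : ℂ) ^ 2 := by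
      funext k x; exact iteratedDeriv_zT_linearChart L (cubic d (evenPeriod t)) (A t) j k x
    rw [e]
    exact boundedBackground_const_mul_sqShift L (cubic d (evenPeriod t)) (hA t) (h2c j)
  · intro j _ k ν' f z
    obtain ⟨s', hs'⟩ := hA1 k ν' f z
    refine ⟨(if j = 1 then (1 : ℂ) else 0) * (-(Complex.I * s')), ?_⟩
    simp only [iteratedDeriv_connV_linearChart]
    exact ((hs'.const_mul Complex.I).neg).const_mul _
  · intro j _ k f z
    choose sA hsA using fun (ν' : Fin d) (y : Fin d → ℤ) => hA1 k ν' f y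
    refine ⟨(if j = 2 then (2 : ℂ) else 0) * ∑ ν', (sA ν' (z - Pi.single ν' 1)) ^ 2, ?_⟩
    have e : ∀ t (ν' : Fin d), tauInv (fine (lev L k) (cubic d (evenPeriod t))) ν' (castT (cubic d (lev L k * evenPeriod t)) z, f)
        = (castT (cubic d (lev L k * evenPeriod t)) (z - Pi.single ν' 1), f) := by
      intro t ν'
      simp only [tauInv]
      rw [sub_eq_add_neg z, castT_add, castT_neg, castT_single, ← sub_eq_add_neg]
      rfl
    simp only [iteratedDeriv_zT_linearChart, e]
    exact (tendsto_finsetSum _ fun ν' _ => (hsA ν' (z - Pi.single ν' 1)).pow 2).const_mul _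

end End

end Summit.QuantumFields.BalabanUV.Beta.GAN24.LinearChartCovariantTaylor

end
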